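/-
Copyright: cell `pub-balaban-gaps` (G2), seat ne6 (row NE7b), `prover-pub-balaban-gaps-ne6-g14-0`, on this seat's `CompactFibreWindowSU2` (gen 11),
leaf-01 g80's `CompactFibreRelative` (OWNER lineage `t4-ne7b-p1` g106's `CompactFibreCarrier`) and the tree's `QuantumLattice.SU2HaarSmallBallUpper` ∕
`SU2HaarChart`. Project licence.
-/
import Summits.QuantumFields.BalabanUV.T4Continuum.Spine.NE7b.CompactFibreRelative
import Summits.QuantumFields.BalabanUV.T4Continuum.Spine.NE7b.CompactFibreWindowSU2
import Literature.MathematicalPhysics.QuantumLattice.SU2HaarSmallBallUpper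

/-!
# THE (n)-CARRIER'S WINDOW-VOLUME LETTER AT PRINT'S RATE `½d(𝔤)` — `SU(2)`, `d(𝔤) = 3`, BOTH SIDES:
# `η√η∕160 ≤ Haar{2 − Re tr U ≤ η} ≤ 12·η√η`, so `−log κ(W_η) = #bonds·((3∕2)·log η⁻¹ + O(1))` (row NE7b, node U5c; MODEL, [folklore])

Cell `pub-balaban-gaps` (G2 spine census, V26) for the `pub-balaban` T⁴ crux NE7b (`T4WeightBudget.RelWeightBound`; the cell's OWN estimate — NOT PRINTED
in [Bałaban 1983–89], NOT PROVED).  Crux-route MODEL work under `Spine/NE7b/`; NOTHING of Bałaban's is named as a hypothesis or asserted; no `def`; zero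
`sorry`.  Imports (oleans present): leaf-01's `…NE7b.CompactFibreRelative` (`relFibre_moment_le_of_centredWindow`), this seat's `…NE7b.CompactFibreWindowSU2`
(V19: `measurableSet_traceWindow`, `haar_traceWindow_toReal_pos`, `pi_traceWindow_toReal_eq`, `pi_traceWindow_toReal_pos`; its letter `neg_log_pi_traceWindow_le`
has rate `2`), the tree's `QuantumLattice.SU2HaarSmallBallUpper` (`haarProbability_su2_two_sub_trace_lt_le`: `Haar{2 − Re tr U < r²} ≤ 4r³`) and chart
`SU2HaarChart.quatReImEquiv : ℍ ≃ᵐ ℝ × ℝ³` (`measurePreserving_quatReImEquiv`).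

WHY.  [Balaban1989LargeFieldII] p. 358 (1.10) prints the creation step's denominator volume as «`E_k(Λ) = (−½d(𝔤)log g_k⁻² + log σ₀)|Λ^{(k)}∖G₀|`»:
per degree of freedom `½d(𝔤)·log g_k⁻²` plus a constant, `d(𝔤) = dim 𝔤` (`= 3` for `SU(2)`) — the Gaussian volume of a window of radius `∝ g_k` in the
`d(𝔤)`-dimensional fibre.  The cell's `SU(2)` MODEL of the (n)-carrier (V19 `CompactFibreWindowSU2`, V25 `CompactFibreCreationFloorSU2`) carries instead
the per-bond letter `2·log η⁻¹ + log 16` for the trace window `W_η = {2 − Re tr V ≤ η}` (`= {‖su2Quat V − 1‖ ≤ √η}`, V19 `traceWindow_eq_quatBall`): rate `2`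
in `η = radius²`, from the tree's `le_haarProbability_su2_two_sub_trace_le` (`≥ η²∕16`, «the true order is `η^{3∕2}`»).  THIS FILE supplies the true order on
BOTH sides, hence the MODEL letter AT PRINT'S RATE `(3∕2)·log η⁻¹ = ½·3·log(radius⁻²)`; it beats the rate-`2` letter as soon as `η < 10⁻²`.

WHAT.  §1 (one bond) **`le_haar_traceWindow_sharp`**: `η√η∕160 ≤ Haar(W_η)` for `0 < η ≤ ¼` — in the tree's cone picture (`haarProbability_su2_eq_su2BallMeasure`)
the thin cylinder `{re x ∈ (½, ¾)} × {|im x|_∞ < √η∕4}` projects into `W_η` (`two_sub_trace_re_quatToSU2_le_of_cylinder`) and has volume `2(√η∕4)³ = η√η∕32`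
against `vol(B⁴) = π²∕2 < 5`; **`haar_traceWindow_le`**: `Haar(W_η) ≤ 12·η√η` (`0 < η`; the tree's upper bound at `r = √(2η)`, `8√2 ≤ 12`); the logs
`neg_log_haar_traceWindow_le_sharp` (`≤ (3∕2)log η⁻¹ + log 160`), `le_neg_log_haar_traceWindow` (`≥ (3∕2)log η⁻¹ − log 12`); and
**`tendsto_neg_log_haar_traceWindow_div_log`**: `−log Haar(W_η) ∕ log η⁻¹ → 3∕2` as `η → 0⁺` — THE EXPONENT IS `3∕2 = ½·dim SU(2)`.  §2 (product Haar on
`bonds → SU(2)`): **`neg_log_pi_traceWindow_le_sharp`** (`−log κ(W) ≤ #bonds·((3∕2)log η⁻¹ + log 160)`), **`le_neg_log_pi_traceWindow`**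
(`≥ #bonds·((3∕2)log η⁻¹ − log 12)`), the pin **`abs_neg_log_pi_traceWindow_sub_le`**: `|−log κ(W) − #bonds·(3∕2)·log η⁻¹| ≤ #bonds·log 160`.  §3: the
creation-step price with an ABSTRACT volume letter (`creationPrice_SU2_of_volumeLetter`: any `b ≥ −log κ(W)` rides in the exponent; V25's `creationPrice_SU2`
is `b = #bonds·(2 log η⁻¹ + log 16)`) and with the sharp one (**`creationPrice_SU2_sharp`**), ledger form `creationPrice_sharp_factor_le_exp_neg`.  §4: at a
window radius `√η = C·g`, `(3∕2)·log η⁻¹ = (3∕2)·log g⁻² − 3·log C` (`volumeLetter_print_shape`, `neg_log_haar_traceWindow_le_print_shape`): print's shape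
«`−½d(𝔤)log g_k⁻² + log σ₀`» with `d(𝔤) = 3` and the constant named.  §5 sanity.

HONEST REMARKS.  MODEL only (`SU(2)`, product Haar, trace windows); [folklore] Haar-measure arithmetic over the tree's cone∕chart description of Haar on
`SU(2)`.  Nothing of Bałaban's asserted or valued beyond quoting (1.10); which window radius `η(g_k)` print's step carries, and that its carrier IS this
one, are (A3) ∕ (A1c), NC-NE7b-α UNRULED; the constants `160`, `12` are this file's, not print's `σ₀`.  BY-NAME EFFECT ON THE WALL: NONE.  NE7b NOT PRINTED ∕
NOT PROVED; spine PROVED 0∕9; rung (B)+1 on ONE finite T⁴ — NOT infinite volume, NOT the mass gap, NOT Clay.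
HONEST DEPENDENCY: continuum YM on T⁴ ⇐ BetaPertH ∧ nine spine estimates (0/9 proved); BetaPertH ⇐ (D1) ∧ (D4) ∧ CAP+tail;
G-an2-4 gates asym, D1 and NE2/3/4.  This file changes none of it.
-/

set_option autoImplicit false

noncomputable section

open MeasureTheory Real Finset Filter Topology
open scoped Quaternion
open Literature.MathematicalPhysics.QuantumFieldTheory (haarProbability)
open Literature.MathematicalPhysics.QuantumLattice (su2Quat quatToSU2 quatReImEquiv quatReImEquiv_apply measurePreserving_quatReImEquiv
  trace_quatToSU2_re sq_norm_eq_sum_sq haarProbability_su2_eq_su2BallMeasure su2BallMeasure measurable_quatToSU2 volume_ball_quat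
  haarProbability_su2_two_sub_trace_lt_le)
open Summit.QuantumFields.BalabanUV.T4Continuum.NE7b.CompactFibreRelative (relFibre_moment_le_of_centredWindow)
open Summit.QuantumFields.BalabanUV.T4Continuum.NE7b.CompactFibreWindowSU2 (measurableSet_traceWindow haar_traceWindow_toReal_pos
  pi_traceWindow_toReal_eq pi_traceWindow_toReal_pos)

namespace Summit.QuantumFields.BalabanUV.T4Continuum.NE7b.CompactFibreWindowSU2Rate

/-! Conventions: `SU(2)` is Mathlib's `Matrix.specialUnitaryGroup (Fin 2) ℂ`; the TRACE WINDOW of half-width `η` is the plain set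
`{U : Matrix.specialUnitaryGroup (Fin 2) ℂ | 2 - ((U : Matrix (Fin 2) (Fin 2) ℂ).trace).re ≤ η}` (written out in full; `W_η` in the prose). -/

/-! ## §1 One bond: the Haar mass of the trace window at the true order `η^{3∕2}`, both sides -/

section OneBond

/-- **THE CONE OVER A THIN CYLINDER LIES IN THE TRACE WINDOW.**  If `re x ∈ (½, ¾)` and `|im x|_∞ < r ≤ ¼` then `x ≠ 0`, `‖x‖ < 1`, and the
radial projection satisfies `2 − Re tr (quatToSU2 x) ≤ 12·r²` (`2 − Re tr = 2(‖x‖ − re x)∕‖x‖`, `‖x‖ − re x = |im x|²∕(‖x‖ + re x) < 3r²`,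
`‖x‖ > ½`). [folklore] -/
theorem two_sub_trace_re_quatToSU2_le_of_cylinder {r : ℝ} (hr : r ≤ 1 / 4) {x : ℍ}
    (hre₁ : 1 / 2 < x.re) (hre₂ : x.re < 3 / 4) (hI : |x.imI| < r) (hJ : |x.imJ| < r) (hK : |x.imK| < r) :
    x ≠ 0 ∧ ‖x‖ < 1 ∧ 2 - (((quatToSU2 x : Matrix.specialUnitaryGroup (Fin 2) ℂ) : Matrix (Fin 2) (Fin 2) ℂ).trace).re ≤ 12 * r ^ 2 := by
  have hrpos : 0 < r := lt_of_le_of_lt (abs_nonneg _) hI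
  set S : ℝ := x.imI ^ 2 + x.imJ ^ 2 + x.imK ^ 2 with hS
  have hI2 : x.imI ^ 2 < r ^ 2 := sq_lt_sq' (abs_lt.1 hI).1 (abs_lt.1 hI).2
  have hJ2 : x.imJ ^ 2 < r ^ 2 := sq_lt_sq' (abs_lt.1 hJ).1 (abs_lt.1 hJ).2
  have hK2 : x.imK ^ 2 < r ^ 2 := sq_lt_sq' (abs_lt.1 hK).1 (abs_lt.1 hK).2
  have hS0 : 0 ≤ S := by positivity
  have hS3 : S < 3 * r ^ 2 := by rw [hS]; linarith
  have hx0 : x ≠ 0 := by intro h; rw [h, Quaternion.re_zero] at hre₁; norm_num at hre₁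
  set n : ℝ := ‖x‖ with hn
  have hn0 : 0 ≤ n := norm_nonneg _
  have hn2 : n ^ 2 = x.re ^ 2 + S := by rw [hn, sq_norm_eq_sum_sq, hS]; ring
  have hnre : x.re ≤ n := by nlinarith
  have hnpos : 0 < n := by linarith
  have hr2 : r ^ 2 ≤ 1 / 16 := by nlinarith
  have hn1 : n < 1 := by nlinarith
  refine ⟨hx0, hn1, ?_⟩
  rw [trace_quatToSU2_re hx0]
  -- `n − re ≤ S` (as `(n − re)(n + re) = S`, `n + re ≥ 1`), then `2(n − re) ≤ 6r² ≤ 12 r² n` (`n ≥ ½`)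
  have hnr : n - x.re ≤ S := by nlinarith
  have key : 2 * (n - x.re) ≤ 12 * r ^ 2 * n := by nlinarith
  have h1 : 2 - 2 * (n⁻¹ * x.re) = n⁻¹ * (2 * (n - x.re)) := by field_simp
  rw [h1]
  calc n⁻¹ * (2 * (n - x.re)) ≤ n⁻¹ * (12 * r ^ 2 * n) := mul_le_mul_of_nonneg_left key (inv_pos.2 hnpos).le
    _ = 12 * r ^ 2 := by field_simp

/-- **LOWER BOUND AT THE TRUE ORDER.**  For `0 < η ≤ ¼`: `Haar_{SU(2)}{U : 2 − Re tr U ≤ η} ≥ η√η∕160` — the cone over the cylinder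
`(½, ¾) × {|im|_∞ < √η∕4}` (volume `2(√η∕4)³ = η√η∕32`) lies in the window's cone inside the unit quaternion ball (volume `π²∕2`), and
`16π² < 160`.  The tree's `le_haarProbability_su2_two_sub_trace_le` gives `η²∕16` (order `2`); the true order is `3∕2` (`haar_traceWindow_le`). [folklore] -/
theorem le_haar_traceWindow_sharp {η : ℝ} (hη0 : 0 < η) (hη : η ≤ 1 / 4) :
    ENNReal.ofReal (η * Real.sqrt η / 160) ≤
      haarProbability (Matrix.specialUnitaryGroup (Fin 2) ℂ) {U : Matrix.specialUnitaryGroup (Fin 2) ℂ | 2 - ((U : Matrix (Fin 2) (Fin 2) ℂ).trace).re ≤ η} := by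
  letI : MeasurableSpace ℍ := Literature.Analysis.FluidPDE.Tao2016.quatMeasurableSpace
  haveI : BorelSpace ℍ := Literature.Analysis.FluidPDE.Tao2016.quatBorelSpace
  set r : ℝ := Real.sqrt η / 4 with hr
  have hsqpos : 0 < Real.sqrt η := Real.sqrt_pos.2 hη0
  have hrpos : 0 < r := by positivity
  have hr2 : r ^ 2 = η / 16 := by rw [hr, div_pow, Real.sq_sqrt hη0.le]; ring
  have hrle : r ≤ 1 / 4 := by have h1 : Real.sqrt η ≤ 1 := Real.sqrt_le_one.2 (by linarith); rw [hr]; linarith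
  have hr3 : 2 * r ^ 3 = η * Real.sqrt η / 32 := by rw [show r ^ 3 = r ^ 2 * r by ring, hr2, hr]; ring
  set T : Set (Matrix.specialUnitaryGroup (Fin 2) ℂ) := {U : Matrix.specialUnitaryGroup (Fin 2) ℂ | 2 - ((U : Matrix (Fin 2) (Fin 2) ℂ).trace).re ≤ η} with hT
  have hTm : MeasurableSet T := measurableSet_traceWindow η
  set Cyl : Set (ℝ × (Fin 3 → ℝ)) := Set.Ioo (1 / 2 : ℝ) (3 / 4) ×ˢ Metric.ball (0 : Fin 3 → ℝ) r with hCyl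
  have hCylm : MeasurableSet Cyl := measurableSet_Ioo.prod Metric.isOpen_ball.measurableSet
  have hsub : quatReImEquiv ⁻¹' Cyl ⊆ quatToSU2 ⁻¹' T ∩ Metric.ball 0 1 := by
    intro x hx
    rw [Set.mem_preimage, quatReImEquiv_apply, hCyl, Set.mem_prod, Set.mem_Ioo, Metric.mem_ball, dist_zero_right,
      pi_norm_lt_iff hrpos] at hx
    obtain ⟨⟨h1, h2⟩, hv⟩ := hx
    have hI : |x.imI| < r := by simpa using hv 0
    have hJ : |x.imJ| < r := by simpa using hv 1
    have hK : |x.imK| < r := by simpa using hv 2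
    obtain ⟨-, hx1, hxT⟩ := two_sub_trace_re_quatToSU2_le_of_cylinder hrle h1 h2 hI hJ hK
    refine ⟨?_, by simpa using hx1⟩
    show 2 - (((quatToSU2 x : Matrix.specialUnitaryGroup (Fin 2) ℂ) : Matrix (Fin 2) (Fin 2) ℂ).trace).re ≤ η
    calc _ ≤ 12 * r ^ 2 := hxT
      _ ≤ η := by rw [hr2]; linarith
  have hvolCyl : (volume : Measure (ℝ × (Fin 3 → ℝ))) Cyl = ENNReal.ofReal (2 * r ^ 3) := by
    rw [hCyl, Measure.volume_eq_prod, Measure.prod_prod, Real.volume_Ioo, Real.volume_pi_ball _ hrpos, Fintype.card_fin,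
      ← ENNReal.ofReal_mul (by norm_num)]
    congr 1; ring
  have hpre : (volume : Measure ℍ) (quatReImEquiv ⁻¹' Cyl) = ENNReal.ofReal (2 * r ^ 3) := by
    rw [measurePreserving_quatReImEquiv.measure_preimage hCylm.nullMeasurableSet, hvolCyl]
  rw [haarProbability_su2_eq_su2BallMeasure, su2BallMeasure, Measure.smul_apply, Measure.map_apply measurable_quatToSU2 hTm,
    Measure.restrict_apply (measurable_quatToSU2 hTm), smul_eq_mul]
  calc ENNReal.ofReal (η * Real.sqrt η / 160)
      ≤ ENNReal.ofReal (2 * r ^ 3 / (Real.pi ^ 2 / 2)) := by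
        refine ENNReal.ofReal_le_ofReal ?_
        rw [hr3, le_div_iff₀ (by positivity)]
        have hπ : Real.pi ^ 2 < 10 := by
          have h := Real.pi_lt_d2
          nlinarith [Real.pi_pos]
        have h0 : 0 ≤ η * Real.sqrt η := by positivity
        nlinarith
    _ = ((volume : Measure ℍ) (Metric.ball 0 1))⁻¹ * (volume : Measure ℍ) (quatReImEquiv ⁻¹' Cyl) := by
        rw [hpre, volume_ball_quat, ENNReal.ofReal_div_of_pos (by positivity), ENNReal.div_eq_inv_mul]
    _ ≤ ((volume : Measure ℍ) (Metric.ball 0 1))⁻¹ * (volume : Measure ℍ) (quatToSU2 ⁻¹' T ∩ Metric.ball 0 1) :=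
        mul_le_mul_right (measure_mono hsub) _

/-- **UPPER BOUND AT THE TRUE ORDER.**  For `0 < η`: `Haar_{SU(2)}{U : 2 − Re tr U ≤ η} ≤ 12·η√η` — the closed window lies in the open one of
radius `r = √(2η)`, where the tree's `haarProbability_su2_two_sub_trace_lt_le` gives `4r³ = 8√2·η√η ≤ 12·η√η`. [folklore] -/
theorem haar_traceWindow_le {η : ℝ} (hη0 : 0 < η) :
    haarProbability (Matrix.specialUnitaryGroup (Fin 2) ℂ)
        {U : Matrix.specialUnitaryGroup (Fin 2) ℂ | 2 - ((U : Matrix (Fin 2) (Fin 2) ℂ).trace).re ≤ η} ≤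
      ENNReal.ofReal (12 * (η * Real.sqrt η)) := by
  have hsub : {U : Matrix.specialUnitaryGroup (Fin 2) ℂ | 2 - ((U : Matrix (Fin 2) (Fin 2) ℂ).trace).re ≤ η} ⊆
      {U : Matrix.specialUnitaryGroup (Fin 2) ℂ | 2 - ((U : Matrix (Fin 2) (Fin 2) ℂ).trace).re < (Real.sqrt (2 * η)) ^ 2} := by
    intro U hU
    simp only [Set.mem_setOf_eq] at hU ⊢
    rw [Real.sq_sqrt (by positivity)]
    linarith
  calc haarProbability (Matrix.specialUnitaryGroup (Fin 2) ℂ) {U : Matrix.specialUnitaryGroup (Fin 2) ℂ | 2 - ((U : Matrix (Fin 2) (Fin 2) ℂ).trace).re ≤ η}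
      ≤ haarProbability (Matrix.specialUnitaryGroup (Fin 2) ℂ)
          {U : Matrix.specialUnitaryGroup (Fin 2) ℂ | 2 - ((U : Matrix (Fin 2) (Fin 2) ℂ).trace).re < (Real.sqrt (2 * η)) ^ 2} := measure_mono hsub
    _ ≤ ENNReal.ofReal (4 * (Real.sqrt (2 * η)) ^ 3) := haarProbability_su2_two_sub_trace_lt_le (by positivity)
    _ ≤ ENNReal.ofReal (12 * (η * Real.sqrt η)) := by
        refine ENNReal.ofReal_le_ofReal ?_
        have h2 : Real.sqrt (2 * η) = Real.sqrt 2 * Real.sqrt η := Real.sqrt_mul (by norm_num) η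
        have h3 : (Real.sqrt (2 * η)) ^ 3 = 2 * η * (Real.sqrt 2 * Real.sqrt η) := by
          rw [show (Real.sqrt (2 * η)) ^ 3 = (Real.sqrt (2 * η)) ^ 2 * Real.sqrt (2 * η) by ring, Real.sq_sqrt (by positivity), h2]
        rw [h3]
        have hs2 : Real.sqrt 2 ≤ 3 / 2 := by
          rw [show (3 / 2 : ℝ) = Real.sqrt ((3 / 2) ^ 2) by rw [Real.sqrt_sq (by norm_num)]]; exact Real.sqrt_le_sqrt (by norm_num)
        have h0 : 0 ≤ η * Real.sqrt η := by positivity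
        nlinarith

/-- Real form of the lower bound: `η√η∕160 ≤ Haar(W_η)` (`0 < η ≤ ¼`). [folklore] -/
theorem haar_traceWindow_toReal_ge_sharp {η : ℝ} (hη0 : 0 < η) (hη : η ≤ 1 / 4) :
    η * Real.sqrt η / 160 ≤
      ((haarProbability (Matrix.specialUnitaryGroup (Fin 2) ℂ)) {U : Matrix.specialUnitaryGroup (Fin 2) ℂ | 2 - ((U : Matrix (Fin 2) (Fin 2) ℂ).trace).re ≤ η}).toReal :=
  (ENNReal.ofReal_le_iff_le_toReal (measure_ne_top _ _)).1 (le_haar_traceWindow_sharp hη0 hη)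

/-- Real form of the upper bound: `Haar(W_η) ≤ 12·η√η` (`0 < η`). [folklore] -/
theorem haar_traceWindow_toReal_le {η : ℝ} (hη0 : 0 < η) :
    ((haarProbability (Matrix.specialUnitaryGroup (Fin 2) ℂ))
        {U : Matrix.specialUnitaryGroup (Fin 2) ℂ | 2 - ((U : Matrix (Fin 2) (Fin 2) ℂ).trace).re ≤ η}).toReal ≤ 12 * (η * Real.sqrt η) :=
  ENNReal.toReal_le_of_le_ofReal (by positivity) (haar_traceWindow_le hη0)

/-- **`−log Haar(W_η) ≤ (3∕2)·log η⁻¹ + log 160`** (`0 < η ≤ ¼`): the per-bond letter at rate `3∕2`. [folklore] -/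
theorem neg_log_haar_traceWindow_le_sharp {η : ℝ} (hη0 : 0 < η) (hη : η ≤ 1 / 4) :
    -Real.log ((haarProbability (Matrix.specialUnitaryGroup (Fin 2) ℂ))
        {U : Matrix.specialUnitaryGroup (Fin 2) ℂ | 2 - ((U : Matrix (Fin 2) (Fin 2) ℂ).trace).re ≤ η}).toReal ≤ 3 / 2 * Real.log η⁻¹ + Real.log 160 := by
  have hpos : 0 < η * Real.sqrt η / 160 := by positivity
  have hlog := Real.log_le_log hpos (haar_traceWindow_toReal_ge_sharp hη0 hη)
  rw [Real.log_div (by positivity) (by norm_num), Real.log_mul hη0.ne' (Real.sqrt_pos.2 hη0).ne', Real.log_sqrt hη0.le] at hlog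
  rw [Real.log_inv]; linarith

/-- **`(3∕2)·log η⁻¹ − log 12 ≤ −log Haar(W_η)`** (`0 < η ≤ ¼`): the same rate from the other side. [folklore] -/
theorem le_neg_log_haar_traceWindow {η : ℝ} (hη0 : 0 < η) (hη : η ≤ 1 / 4) :
    3 / 2 * Real.log η⁻¹ - Real.log 12 ≤ -Real.log ((haarProbability (Matrix.specialUnitaryGroup (Fin 2) ℂ))
        {U : Matrix.specialUnitaryGroup (Fin 2) ℂ | 2 - ((U : Matrix (Fin 2) (Fin 2) ℂ).trace).re ≤ η}).toReal := by
  have hm := haar_traceWindow_toReal_pos hη0 hη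
  have hlog := Real.log_le_log hm (haar_traceWindow_toReal_le hη0)
  rw [Real.log_mul (by norm_num) (by positivity), Real.log_mul hη0.ne' (Real.sqrt_pos.2 hη0).ne', Real.log_sqrt hη0.le] at hlog
  rw [Real.log_inv]; linarith

/-- **THE EXPONENT IS `3∕2 = ½·dim SU(2)`:** `−log Haar(W_η) ∕ log η⁻¹ → 3∕2` as `η → 0⁺` (squeeze between the two bounds). This is print's
«`½d(𝔤)`» of [Balaban1989LargeFieldII] (1.10) in the `SU(2)` MODEL (`η = radius²`). [folklore] -/
theorem tendsto_neg_log_haar_traceWindow_div_log :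
    Tendsto (fun η : ℝ => -Real.log ((haarProbability (Matrix.specialUnitaryGroup (Fin 2) ℂ))
        {U : Matrix.specialUnitaryGroup (Fin 2) ℂ | 2 - ((U : Matrix (Fin 2) (Fin 2) ℂ).trace).re ≤ η}).toReal / Real.log η⁻¹) (𝓝[>] 0) (𝓝 (3 / 2)) := by
  have hL : Tendsto (fun η : ℝ => Real.log η⁻¹) (𝓝[>] 0) atTop := by
    simp_rw [Real.log_inv]; exact tendsto_neg_atBot_atTop.comp Real.tendsto_log_nhdsGT_zero
  have hup : Tendsto (fun η : ℝ => 3 / 2 + Real.log 160 / Real.log η⁻¹) (𝓝[>] 0) (𝓝 (3 / 2)) := by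
    simpa using tendsto_const_nhds.add (tendsto_const_nhds.div_atTop hL)
  have hlow : Tendsto (fun η : ℝ => 3 / 2 - Real.log 12 / Real.log η⁻¹) (𝓝[>] 0) (𝓝 (3 / 2)) := by
    simpa using tendsto_const_nhds.sub (tendsto_const_nhds.div_atTop hL)
  have hwin : ∀ᶠ η : ℝ in 𝓝[>] 0, 0 < η ∧ η ≤ 1 / 4 := by
    filter_upwards [eventually_mem_nhdsWithin (s := Set.Ioi (0 : ℝ)) (a := 0),
      (eventually_lt_nhds (by norm_num : (0 : ℝ) < 1 / 4)).filter_mono nhdsWithin_le_nhds] with η h1 h2 using ⟨h1, h2.le⟩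
  refine tendsto_of_tendsto_of_tendsto_of_le_of_le' hlow hup ?_ ?_
  · filter_upwards [hwin] with η hη
    have hLpos : 0 < Real.log η⁻¹ := Real.log_pos (by rw [lt_inv_comm₀ one_pos hη.1, inv_one]; linarith)
    rw [le_div_iff₀ hLpos, sub_mul, div_mul_cancel₀ _ hLpos.ne']
    exact le_neg_log_haar_traceWindow hη.1 hη.2
  · filter_upwards [hwin] with η hη
    have hLpos : 0 < Real.log η⁻¹ := Real.log_pos (by rw [lt_inv_comm₀ one_pos hη.1, inv_one]; linarith)
    rw [div_le_iff₀ hLpos, add_mul, div_mul_cancel₀ _ hLpos.ne']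
    exact neg_log_haar_traceWindow_le_sharp hη.1 hη.2

end OneBond

/-! ## §2 A region: the product Haar window over its bonds — the per-degree-of-freedom letter is `(3∕2)·log η⁻¹ + O(1)` on both sides -/

section Region

variable {B : Type*} [Fintype B]

/-- **THE PER-DEGREE-OF-FREEDOM LETTER AT PRINT'S RATE, UPPER SIDE**: `−log κ(W) ≤ #bonds·((3∕2)·log η⁻¹ + log 160)` for the product trace
window of half-width `η ∈ (0, ¼]` under the product Haar measure on `bonds → SU(2)`. [folklore] -/
theorem neg_log_pi_traceWindow_le_sharp {η : ℝ} (hη0 : 0 < η) (hη : η ≤ 1 / 4) :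
    -Real.log ((Measure.pi fun _ : B => haarProbability (Matrix.specialUnitaryGroup (Fin 2) ℂ))
        (Set.univ.pi fun _ : B => {U : Matrix.specialUnitaryGroup (Fin 2) ℂ | 2 - ((U : Matrix (Fin 2) (Fin 2) ℂ).trace).re ≤ η})).toReal ≤
      (Fintype.card B : ℝ) * (3 / 2 * Real.log η⁻¹ + Real.log 160) := by
  rw [pi_traceWindow_toReal_eq, Real.log_pow, ← mul_neg]
  exact mul_le_mul_of_nonneg_left (neg_log_haar_traceWindow_le_sharp hη0 hη) (Nat.cast_nonneg _)

/-- **THE SAME LETTER, LOWER SIDE**: `#bonds·((3∕2)·log η⁻¹ − log 12) ≤ −log κ(W)` (`0 < η ≤ ¼`). [folklore] -/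
theorem le_neg_log_pi_traceWindow {η : ℝ} (hη0 : 0 < η) (hη : η ≤ 1 / 4) :
    (Fintype.card B : ℝ) * (3 / 2 * Real.log η⁻¹ - Real.log 12) ≤
      -Real.log ((Measure.pi fun _ : B => haarProbability (Matrix.specialUnitaryGroup (Fin 2) ℂ))
        (Set.univ.pi fun _ : B => {U : Matrix.specialUnitaryGroup (Fin 2) ℂ | 2 - ((U : Matrix (Fin 2) (Fin 2) ℂ).trace).re ≤ η})).toReal := by
  rw [pi_traceWindow_toReal_eq, Real.log_pow, ← mul_neg]
  exact mul_le_mul_of_nonneg_left (le_neg_log_haar_traceWindow hη0 hη) (Nat.cast_nonneg _)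

/-- **TWO-SIDED PIN**: `|−log κ(W) − #bonds·(3∕2)·log η⁻¹| ≤ #bonds·log 160` (`0 < η ≤ ¼`) — the window-volume letter of the `SU(2)` MODEL IS
`(3∕2)·log η⁻¹` per bond up to a bounded constant per bond: print's «`−½d(𝔤)log g_k⁻² + log σ₀`» with `d(𝔤) = 3`. [folklore] -/
theorem abs_neg_log_pi_traceWindow_sub_le {η : ℝ} (hη0 : 0 < η) (hη : η ≤ 1 / 4) :
    |-Real.log ((Measure.pi fun _ : B => haarProbability (Matrix.specialUnitaryGroup (Fin 2) ℂ))
        (Set.univ.pi fun _ : B => {U : Matrix.specialUnitaryGroup (Fin 2) ℂ | 2 - ((U : Matrix (Fin 2) (Fin 2) ℂ).trace).re ≤ η})).toReal -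
        (Fintype.card B : ℝ) * (3 / 2 * Real.log η⁻¹)| ≤ (Fintype.card B : ℝ) * Real.log 160 := by
  have hup := neg_log_pi_traceWindow_le_sharp (B := B) hη0 hη
  have hlow := le_neg_log_pi_traceWindow (B := B) hη0 hη
  have h12n : (Fintype.card B : ℝ) * Real.log 12 ≤ (Fintype.card B : ℝ) * Real.log 160 :=
    mul_le_mul_of_nonneg_left (Real.log_le_log (by norm_num) (by norm_num)) (Nat.cast_nonneg _)
  rw [abs_le]; constructor <;> nlinarith

end Region

/-! ## §3 The (n)-carrier's creation-step price with the sharp volume letter -/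

section SU2

variable {B : Type*} [Fintype B] {Y : Type*} [MeasurableSpace Y] (μ : Measure Y) [SFinite μ]

/-- **THE CREATION-STEP PRICE WITH AN ABSTRACT VOLUME LETTER** (`SU(2)` MODEL): V25's `creationPrice_SU2` with the window volume entering only
through a letter `b ≥ −log κ(W)`: `∫ F·w·e^{−I} ≤ exp(i₀ − (λ∕2)δ′² + b)·(∫F dκ)·∫ G·w·e^{−I}` (near fibre `bonds → SU(2)`, product Haar probability; far
space `(Y, μ)`; `F, G, w ≥ 0`; `G ≥ 1` on the centred product trace window (`hGwin`), excess of `I` over the base level `m₀ y` there `≤ i₀` (`hIrel`);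
`F` supported where SOME bond is at quaternion distance `≥ δ′` from the centre (`hF`), bond-quadratic floor of modulus `λ` there (`hconv`)). [folklore] -/
theorem creationPrice_SU2_of_volumeLetter {η b : ℝ} (hη0 : 0 < η) (hη : η ≤ 1 / 4)
    (hvol : -Real.log ((Measure.pi fun _ : B => haarProbability (Matrix.specialUnitaryGroup (Fin 2) ℂ))
        (Set.univ.pi fun _ : B => {U : Matrix.specialUnitaryGroup (Fin 2) ℂ | 2 - ((U : Matrix (Fin 2) (Fin 2) ℂ).trace).re ≤ η})).toReal ≤ b)
    (F G : (B → Matrix.specialUnitaryGroup (Fin 2) ℂ) → ℝ) (w : Y → ℝ) (I : (B → Matrix.specialUnitaryGroup (Fin 2) ℂ) × Y → ℝ) (m₀ : Y → ℝ)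
    (U₀ : Y → (B → Matrix.specialUnitaryGroup (Fin 2) ℂ)) {i₀ lam δ' : ℝ} (hF0 : ∀ x, 0 ≤ F x) (hG0 : ∀ x, 0 ≤ G x) (hw0 : ∀ y, 0 ≤ w y) (hlam : 0 ≤ lam) (hδ : 0 ≤ δ')
    (hF : ∀ x y, F x ≠ 0 → w y ≠ 0 → ∃ b : B, δ' ≤ ‖su2Quat ((U₀ y b)⁻¹ * x b) - 1‖)
    (hconv : ∀ x y, F x ≠ 0 → w y ≠ 0 → m₀ y + lam / 2 * ∑ b, ‖su2Quat ((U₀ y b)⁻¹ * x b) - 1‖ ^ 2 ≤ I (x, y))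
    (hGwin : ∀ y v, w y ≠ 0 → v ∈ (Set.univ.pi fun _ : B => {U : Matrix.specialUnitaryGroup (Fin 2) ℂ | 2 - ((U : Matrix (Fin 2) (Fin 2) ℂ).trace).re ≤ η}) →
      1 ≤ G (U₀ y * v))
    (hIrel : ∀ y v, w y ≠ 0 → v ∈ (Set.univ.pi fun _ : B => {U : Matrix.specialUnitaryGroup (Fin 2) ℂ | 2 - ((U : Matrix (Fin 2) (Fin 2) ℂ).trace).re ≤ η}) →
      I (U₀ y * v, y) ≤ m₀ y + i₀)
    (hFi : Integrable F (Measure.pi fun _ : B => haarProbability (Matrix.specialUnitaryGroup (Fin 2) ℂ)))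
    (hGI : ∀ y, w y ≠ 0 → Integrable (fun x => G x * exp (-I (x, y))) (Measure.pi fun _ : B => haarProbability (Matrix.specialUnitaryGroup (Fin 2) ℂ)))
    (hA' : Integrable (fun z : (B → Matrix.specialUnitaryGroup (Fin 2) ℂ) × Y => F z.1 * w z.2 * exp (-I z)) ((Measure.pi fun _ : B => haarProbability (Matrix.specialUnitaryGroup (Fin 2) ℂ)).prod μ))
    (hB' : Integrable (fun z : (B → Matrix.specialUnitaryGroup (Fin 2) ℂ) × Y => G z.1 * w z.2 * exp (-I z)) ((Measure.pi fun _ : B => haarProbability (Matrix.specialUnitaryGroup (Fin 2) ℂ)).prod μ)) :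
    ∫ z, F z.1 * w z.2 * exp (-I z) ∂((Measure.pi fun _ : B => haarProbability (Matrix.specialUnitaryGroup (Fin 2) ℂ)).prod μ) ≤
      exp (i₀ - lam / 2 * δ' ^ 2 + b) *
        (∫ x, F x ∂(Measure.pi fun _ : B => haarProbability (Matrix.specialUnitaryGroup (Fin 2) ℂ))) * ∫ z, G z.1 * w z.2 * exp (-I z) ∂((Measure.pi fun _ : B => haarProbability (Matrix.specialUnitaryGroup (Fin 2) ℂ)).prod μ) := by
  set κ : Measure (B → Matrix.specialUnitaryGroup (Fin 2) ℂ) := Measure.pi fun _ : B => haarProbability (Matrix.specialUnitaryGroup (Fin 2) ℂ)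
    with hκ
  set W : Set (B → Matrix.specialUnitaryGroup (Fin 2) ℂ) :=
    Set.univ.pi fun _ : B => {U : Matrix.specialUnitaryGroup (Fin 2) ℂ | 2 - ((U : Matrix (Fin 2) (Fin 2) ℂ).trace).re ≤ η} with hW
  have hWm : MeasurableSet W := MeasurableSet.univ_pi fun _ => measurableSet_traceWindow η
  have hWpos : 0 < κ.real W := by rw [measureReal_def]; exact pi_traceWindow_toReal_pos hη0 hη
  have hvol' : -Real.log (κ.real W) ≤ b := by rw [measureReal_def]; exact hvol
  -- the floor rides in the level: `m y := m₀ y + (λ∕2)δ′²`, excess `i₀ − (λ∕2)δ′²`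
  have hnum : ∀ x y, F x ≠ 0 → w y ≠ 0 → m₀ y + lam / 2 * δ' ^ 2 ≤ I (x, y) := by
    intro x y hx hy
    obtain ⟨b, hb⟩ := hF x y hx hy
    have hsq : δ' ^ 2 ≤ ∑ b, ‖su2Quat ((U₀ y b)⁻¹ * x b) - 1‖ ^ 2 := (pow_le_pow_left₀ hδ hb 2).trans
      (Finset.single_le_sum (f := fun b => ‖su2Quat ((U₀ y b)⁻¹ * x b) - 1‖ ^ 2) (fun b _ => sq_nonneg _) (Finset.mem_univ b))
    have := mul_le_mul_of_nonneg_left hsq (by positivity : 0 ≤ lam / 2)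
    linarith [hconv x y hx hy]
  have hIrel' : ∀ y v, w y ≠ 0 → v ∈ W → I (U₀ y * v, y) ≤ (m₀ y + lam / 2 * δ' ^ 2) + (i₀ - lam / 2 * δ' ^ 2) := by
    intro y v hy hv; have := hIrel y v hy hv; linarith
  have key := relFibre_moment_le_of_centredWindow κ μ F G w I (fun y => m₀ y + lam / 2 * δ' ^ 2) U₀ W hF0 hG0 hw0 hWm hWpos
    hnum hGwin hIrel' hFi hGI hA' hB'
  have hint : 0 ≤ ∫ z, G z.1 * w z.2 * exp (-I z) ∂(κ.prod μ) :=
    integral_nonneg fun z => mul_nonneg (mul_nonneg (hG0 _) (hw0 _)) (exp_pos _).le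
  have hFint : 0 ≤ ∫ x, F x ∂κ := integral_nonneg hF0
  -- fold the volume letter into the exponent: `e^{c}·(A ∕ m) ≤ e^{c + b}·A`
  have hinv : (κ.real W)⁻¹ ≤ exp b := by
    rw [← Real.exp_log hWpos, ← Real.exp_neg]
    exact Real.exp_le_exp.2 hvol'
  have hstep : exp (i₀ - lam / 2 * δ' ^ 2) * ((∫ x, F x ∂κ) / κ.real W) ≤ exp (i₀ - lam / 2 * δ' ^ 2 + b) * ∫ x, F x ∂κ := by
    rw [div_eq_mul_inv, Real.exp_add]
    have hc : 0 ≤ exp (i₀ - lam / 2 * δ' ^ 2) := (exp_pos _).le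
    calc exp (i₀ - lam / 2 * δ' ^ 2) * ((∫ x, F x ∂κ) * (κ.real W)⁻¹)
        = exp (i₀ - lam / 2 * δ' ^ 2) * (∫ x, F x ∂κ) * (κ.real W)⁻¹ := by ring
      _ ≤ exp (i₀ - lam / 2 * δ' ^ 2) * (∫ x, F x ∂κ) * exp b := mul_le_mul_of_nonneg_left hinv (mul_nonneg hc hFint)
      _ = exp (i₀ - lam / 2 * δ' ^ 2) * exp b * ∫ x, F x ∂κ := by ring
  exact key.trans (mul_le_mul_of_nonneg_right hstep hint)

/-- **THE (n)-CARRIER'S CREATION-STEP PRICE WITH THE SHARP LETTER** (`SU(2)` MODEL): as V25's `creationPrice_SU2`, with the volume letter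
at print's rate — `∫ F·w·e^{−I} ≤ exp(i₀ − (λ∕2)δ′² + #bonds·((3∕2)·log η⁻¹ + log 160))·(∫F dκ)·∫ G·w·e^{−I}`. [folklore] -/
theorem creationPrice_SU2_sharp {η : ℝ} (hη0 : 0 < η) (hη : η ≤ 1 / 4)
    (F G : (B → Matrix.specialUnitaryGroup (Fin 2) ℂ) → ℝ) (w : Y → ℝ) (I : (B → Matrix.specialUnitaryGroup (Fin 2) ℂ) × Y → ℝ) (m₀ : Y → ℝ)
    (U₀ : Y → (B → Matrix.specialUnitaryGroup (Fin 2) ℂ)) {i₀ lam δ' : ℝ} (hF0 : ∀ x, 0 ≤ F x) (hG0 : ∀ x, 0 ≤ G x) (hw0 : ∀ y, 0 ≤ w y) (hlam : 0 ≤ lam) (hδ : 0 ≤ δ')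
    (hF : ∀ x y, F x ≠ 0 → w y ≠ 0 → ∃ b : B, δ' ≤ ‖su2Quat ((U₀ y b)⁻¹ * x b) - 1‖)
    (hconv : ∀ x y, F x ≠ 0 → w y ≠ 0 → m₀ y + lam / 2 * ∑ b, ‖su2Quat ((U₀ y b)⁻¹ * x b) - 1‖ ^ 2 ≤ I (x, y))
    (hGwin : ∀ y v, w y ≠ 0 → v ∈ (Set.univ.pi fun _ : B => {U : Matrix.specialUnitaryGroup (Fin 2) ℂ | 2 - ((U : Matrix (Fin 2) (Fin 2) ℂ).trace).re ≤ η}) →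
      1 ≤ G (U₀ y * v))
    (hIrel : ∀ y v, w y ≠ 0 → v ∈ (Set.univ.pi fun _ : B => {U : Matrix.specialUnitaryGroup (Fin 2) ℂ | 2 - ((U : Matrix (Fin 2) (Fin 2) ℂ).trace).re ≤ η}) →
      I (U₀ y * v, y) ≤ m₀ y + i₀)
    (hFi : Integrable F (Measure.pi fun _ : B => haarProbability (Matrix.specialUnitaryGroup (Fin 2) ℂ)))
    (hGI : ∀ y, w y ≠ 0 → Integrable (fun x => G x * exp (-I (x, y))) (Measure.pi fun _ : B => haarProbability (Matrix.specialUnitaryGroup (Fin 2) ℂ)))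
    (hA' : Integrable (fun z : (B → Matrix.specialUnitaryGroup (Fin 2) ℂ) × Y => F z.1 * w z.2 * exp (-I z)) ((Measure.pi fun _ : B => haarProbability (Matrix.specialUnitaryGroup (Fin 2) ℂ)).prod μ))
    (hB' : Integrable (fun z : (B → Matrix.specialUnitaryGroup (Fin 2) ℂ) × Y => G z.1 * w z.2 * exp (-I z)) ((Measure.pi fun _ : B => haarProbability (Matrix.specialUnitaryGroup (Fin 2) ℂ)).prod μ)) :
    ∫ z, F z.1 * w z.2 * exp (-I z) ∂((Measure.pi fun _ : B => haarProbability (Matrix.specialUnitaryGroup (Fin 2) ℂ)).prod μ) ≤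
      exp (i₀ - lam / 2 * δ' ^ 2 + (Fintype.card B : ℝ) * (3 / 2 * Real.log η⁻¹ + Real.log 160)) *
        (∫ x, F x ∂(Measure.pi fun _ : B => haarProbability (Matrix.specialUnitaryGroup (Fin 2) ℂ))) * ∫ z, G z.1 * w z.2 * exp (-I z) ∂((Measure.pi fun _ : B => haarProbability (Matrix.specialUnitaryGroup (Fin 2) ℂ)).prod μ) :=
  creationPrice_SU2_of_volumeLetter μ hη0 hη (neg_log_pi_traceWindow_le_sharp hη0 hη) F G w I m₀ U₀ hF0 hG0 hw0 hlam hδ hF hconv hGwin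
    hIrel hFi hGI hA' hB'

end SU2

/-- **WHEN THE STEP SELLS `e^{−P}`, SHARP LETTER**: with `∫F dκ ≤ 1` the factor in `creationPrice_SU2_sharp` is at most `e^{−P}` as soon as
`P + i₀ + #bonds·((3∕2)·log η⁻¹ + log 160) ≤ (λ∕2)δ′²`. [folklore] -/
theorem creationPrice_sharp_factor_le_exp_neg {η i₀ lam δ' A P : ℝ} {n : ℕ} (hA1 : A ≤ 1)
    (hledger : P + i₀ + (n : ℝ) * (3 / 2 * Real.log η⁻¹ + Real.log 160) ≤ lam / 2 * δ' ^ 2) :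
    exp (i₀ - lam / 2 * δ' ^ 2 + (n : ℝ) * (3 / 2 * Real.log η⁻¹ + Real.log 160)) * A ≤ exp (-P) := by
  refine (mul_le_mul_of_nonneg_left hA1 (exp_pos _).le).trans ?_
  rw [mul_one]; exact Real.exp_le_exp.2 (by linarith)

/-! ## §4 Print's shape: «`−½d(𝔤)log g_k⁻² + log σ₀`» per degree of freedom, `d(𝔤) = 3` -/

/-- **PRINT'S SHAPE OF THE LETTER.**  At a window radius `√η = C·g` (`C, g > 0`): `(3∕2)·log η⁻¹ = (3∕2)·log g⁻² − 3·log C` — the `SU(2)` MODEL's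
per-bond letter is `½·d(𝔤)·log g⁻²` plus a constant, `d(𝔤) = 3 = dim SU(2)`, the shape of [Balaban1989LargeFieldII] (1.10)'s
«`−½d(𝔤)log g_k⁻² + log σ₀`» (whose window is `|B′| < M₀g_k⁻¹ε_k` in the Lie algebra, (1.2)). Which `C(g_k)` print carries is (A3). [folklore] -/
theorem volumeLetter_print_shape {C g : ℝ} (hC : 0 < C) (hg : 0 < g) :
    3 / 2 * Real.log ((C * g) ^ 2)⁻¹ = 3 / 2 * Real.log (g ^ 2)⁻¹ - 3 * Real.log C := by
  rw [Real.log_inv, Real.log_inv, Real.log_pow, Real.log_pow, Real.log_mul hC.ne' hg.ne']; push_cast; ring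

/-- Hence, per bond and at radius `√η = C·g` with `η ≤ ¼`: `−log Haar(W_η) ≤ (3∕2)·log g⁻² + (log 160 − 3·log C)` — rate `½d(𝔤) = 3∕2` in `log g⁻²`,
constant `log 160 − 3 log C` in place of print's `−log σ₀`. [folklore] -/
theorem neg_log_haar_traceWindow_le_print_shape {C g : ℝ} (hC : 0 < C) (hg : 0 < g) (hη : (C * g) ^ 2 ≤ 1 / 4) :
    -Real.log ((haarProbability (Matrix.specialUnitaryGroup (Fin 2) ℂ))
        {U : Matrix.specialUnitaryGroup (Fin 2) ℂ | 2 - ((U : Matrix (Fin 2) (Fin 2) ℂ).trace).re ≤ (C * g) ^ 2}).toReal ≤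
      3 / 2 * Real.log (g ^ 2)⁻¹ + (Real.log 160 - 3 * Real.log C) := by
  have h := neg_log_haar_traceWindow_le_sharp (by positivity : 0 < (C * g) ^ 2) hη; rw [volumeLetter_print_shape hC hg] at h; linarith

/-! ## §5 Sanity -/

/-- Toy for §1∕§4: at `C = 1` the constant is `log 160` (`log 1 = 0`). -/
example {g : ℝ} (hg : 0 < g) : 3 / 2 * Real.log ((1 * g) ^ 2)⁻¹ = 3 / 2 * Real.log (g ^ 2)⁻¹ - 3 * Real.log 1 :=
  volumeLetter_print_shape one_pos hg

end Summit.QuantumFields.BalabanUV.T4Continuum.NE7b.CompactFibreWindowSU2Rate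

end
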